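import Summits.AtomisticToContinuum.Crystallization.Theorems.FrustratedLawDichotomyStrainedPatchHomEntryLeafHTA2QS

/-!
# Cell-side exposure lemmas for the exterior certificate (E3): the reference shuffle, the reference force bound `hf₀`, and the label-set correction
# (27623 `(H) HomFloor`, hcp half; hand-1 g40; critic row 1474 (C) «ASK successor hand-1: … the cell-side hf₀ exposure lemma (refForce_htBU_leA2-type)»;
#  hand-2 g39 NODE E3 contracts (E3a)–(E3d))

A landed production T-cell exports ONE Boolean fact `htCertSideA2QS p Q Gn J c w = true` (e.g. `…CellG70V3.htCertSideA2QS_G70V`).  The exterior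
certificate of record (R3, E2′ nested chain; real side `…HomExteriorPieces.hver_of_slabParts_pieces`) needs from the CELL, at every `U` of the cell's
entry box, with the affine reference shuffle `ξ₀ = affShuf J c U`:

* §1 `affShuf_mem_box_of_certSide` / `norm_affShuf_le_of_certSide` — `ξ₀` lies in the cell's shuffle box and in the quarter ball;
* §2 ★ `refForce_htBU_le_of_certSide` — THE `hf₀` HYPOTHESIS over `B = (htBU c w).toFinset` with `f₀ = p.Gs / SC`
  (`|Σ_{bb ∈ B} β(‖X_bb(ξ₀)‖) ⟪X_bb(ξ₀), U(ξ − ξ₀)⟫| ≤ p.Gs/SC · ‖U(ξ − ξ₀)‖`, every `ξ : E3` — the slab point need NOT lie in the cell);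
* §3 `abs_forceTerm_le_of_six_le` — one label at distance `≥ 6` contributes at most `6⁻⁷‖v‖`; `six_le_norm_ref_of_lo` — the decidable cell-box test
  `36·SC ≤ (fjQ c w bb).lo` puts label `bb` at distance `≥ 6` from the reference atom `X_bb(ξ₀)`;
* §4 ★ `refForce_le_of_certSide_corr` — `hf₀` over an ARBITRARY label finset `B'` (the slab's own certainly-inside set of hand-2's `exteriorOK`):
  `f₀ = p.Gs/SC + (#(B' \ B) + #(B \ B')) · 6⁻⁷`, provided every label of the symmetric difference passes the cell-box test above.

Def-free (161 lines); 0 sorry; standard axioms; no instances / notation / `#eval`.  `--supports stmt-AtomisticToContinuum-27623`.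
-/

noncomputable section

namespace Summit.AtomisticToContinuum.Crystallization.Theorems.FrustratedLawDichotomyStrainedPatchHomEntryLeafHT

open scoped BigOperators RealInnerProductSpace
open Literature.Analysis.ValidatedNumerics.Numerics
open Summit.AtomisticToContinuum.Crystallization.Theorems.ChargedEnergyGapNegative (E3)
open Summit.AtomisticToContinuum.Crystallization.Theorems.FrustratedLawDichotomyStrainedPatchHomSplit (latPt hexFrame hcpShift)
open Summit.AtomisticToContinuum.Crystallization.Theorems.FrustratedLawDichotomyStrainedPatchHomForceJacN (fjQ boxLabels11 boxLabels11_toFinset)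
open Summit.AtomisticToContinuum.Crystallization.Theorems.FrustratedLawDichotomyStrainedPatchHomSlopeLJAffine
open Summit.AtomisticToContinuum.Crystallization.Theorems.FrustratedLawDichotomyStrainedPatchHomForceHcp (xiBallOK norm_le_quarter_of_xiBallOK)

/-! ## §1. The affine reference shuffle of a certified cell -/

/-- The affine reference shuffle `affShuf J c U` lies in the cell's shuffle box, for every `U` of the cell's entry box. [formal bookkeeping:
`abs_affShuf_sub_le` + the `jacOK` clause of the certificate] -/
theorem affShuf_mem_box_of_certSide {p : HTCert} {Q : Fin 3 → ℤ} {Gn : ℤ} {J : Fin 3 → Fin 3 × Fin 3 → ℤ} {c w : (Fin 3 × Fin 3) ⊕ Fin 3 → ℤ}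
    (h : htCertSideA2QS p Q Gn J c w = true) (U : E3 →L[ℝ] E3)
    (hbox : ∀ ab : Fin 3 × Fin 3, |(U (EuclideanSpace.single ab.2 (1 : ℝ))) ab.1 - (c (Sum.inl ab) : ℝ) / SC| ≤ (w (Sum.inl ab) : ℝ) / SC)
    (i : Fin 3) : |affShuf J c U i - (c (Sum.inr i) : ℝ) / SC| ≤ (w (Sum.inr i) : ℝ) / SC := by
  have hS : (0 : ℝ) < SC := by norm_num [SC]
  unfold htCertSideA2QS at h
  simp only [Bool.and_eq_true, decide_eq_true_eq] at h
  obtain ⟨⟨⟨⟨⟨⟨⟨⟨_, hjac⟩, _⟩, _⟩, _⟩, _⟩, _⟩, _⟩, _⟩ := h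
  refine (abs_affShuf_sub_le (J := J) (w := w) U hbox i).trans ?_
  rw [div_le_div_iff_of_pos_right hS]
  exact_mod_cast jacOK_spec hjac i

/-- The affine reference shuffle lies in the quarter ball. [formal bookkeeping: `xiBallOK` clause + §1] -/
theorem norm_affShuf_le_of_certSide {p : HTCert} {Q : Fin 3 → ℤ} {Gn : ℤ} {J : Fin 3 → Fin 3 × Fin 3 → ℤ} {c w : (Fin 3 × Fin 3) ⊕ Fin 3 → ℤ}
    (h : htCertSideA2QS p Q Gn J c w = true) (U : E3 →L[ℝ] E3)
    (hbox : ∀ ab : Fin 3 × Fin 3, |(U (EuclideanSpace.single ab.2 (1 : ℝ))) ab.1 - (c (Sum.inl ab) : ℝ) / SC| ≤ (w (Sum.inl ab) : ℝ) / SC) :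
    ‖affShuf J c U‖ ≤ 1 / 4 := by
  have hball : xiBallOK c w = true := by
    unfold htCertSideA2QS at h
    simp only [Bool.and_eq_true, decide_eq_true_eq] at h
    obtain ⟨⟨⟨⟨⟨⟨⟨⟨hball, _⟩, _⟩, _⟩, _⟩, _⟩, _⟩, _⟩, _⟩ := h
    exact hball
  exact norm_le_quarter_of_xiBallOK hball (affShuf_mem_box_of_certSide h U hbox)

/-! ## §2. ★ The reference force bound `hf₀` over the cell's label set `htBU` -/

/-- ★ **THE CELL'S `hf₀`**: for every `U` of the entry box and EVERY `ξ : E3`, the pure Lennard-Jones reference force over `B = htBU c w` at the affine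
reference `ξ₀ = affShuf J c U`, projected on `U(ξ − ξ₀)`, is at most `p.Gs/SC · ‖U(ξ − ξ₀)‖` — the exact `hf₀` hypothesis shape of
`…HomExteriorPieces.hver_of_slabParts_pieces` / `…HomExteriorTaylor.hver_of_slabParts_taylor`. [folklore chaining: `refForce_htBU_leA2QS` + the
`Gn + far₁ + far₂ ≤ p.Gs` clause of the certificate; verbatim the `hf₀` step of `entryLeafOKHT4A2QS_sound`] -/
theorem refForce_htBU_le_of_certSide {p : HTCert} {Q : Fin 3 → ℤ} {Gn : ℤ} {J : Fin 3 → Fin 3 × Fin 3 → ℤ} {c w : (Fin 3 × Fin 3) ⊕ Fin 3 → ℤ}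
    (h : htCertSideA2QS p Q Gn J c w = true) (U : E3 →L[ℝ] E3) (hU : ‖U - 1‖ ≤ 1 / 4)
    (hbox : ∀ ab : Fin 3 × Fin 3, |(U (EuclideanSpace.single ab.2 (1 : ℝ))) ab.1 - (c (Sum.inl ab) : ℝ) / SC| ≤ (w (Sum.inl ab) : ℝ) / SC) (ξ : E3) :
    |∑ bb ∈ (htBU c w).toFinset, (‖latPt U hexFrame bb + U (hcpShift + affShuf J c U)‖⁻¹ ^ 8 - ‖latPt U hexFrame bb + U (hcpShift + affShuf J c U)‖⁻¹ ^ 14) *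
        ⟪latPt U hexFrame bb + U (hcpShift + affShuf J c U), U (ξ - affShuf J c U)⟫| ≤ (p.Gs : ℝ) / SC * ‖U (ξ - affShuf J c U)‖ := by
  have hS : (0 : ℝ) < SC := by norm_num [SC]
  have hn₀ := norm_affShuf_le_of_certSide h U hbox
  unfold htCertSideA2QS at h
  simp only [Bool.and_eq_true, decide_eq_true_eq] at h
  obtain ⟨⟨_, ⟨⟨hs1, hs2⟩, hs3⟩⟩, hGs⟩ := h
  have key := refForce_htBU_leA2QS hs1 hs2 hs3 U hU hbox hn₀ ξ
  refine key.trans (mul_le_mul_of_nonneg_right ?_ (norm_nonneg _))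
  rw [div_le_div_iff_of_pos_right hS]
  exact_mod_cast hGs

/-! ## §3. One-label bounds for the label-set correction -/

/-- A label at distance `≥ 6` contributes at most `6⁻⁷ · ‖v‖` to the projected reference force. [calculus: `0 ≤ r⁻⁸ − r⁻¹⁴ ≤ r⁻⁸` for `r ≥ 1`,
Cauchy–Schwarz, `r⁻⁷ ≤ 6⁻⁷`] -/
theorem abs_forceTerm_le_of_six_le {X v : E3} (hX : 6 ≤ ‖X‖) :
    |(‖X‖⁻¹ ^ 8 - ‖X‖⁻¹ ^ 14) * ⟪X, v⟫| ≤ (6 : ℝ)⁻¹ ^ 7 * ‖v‖ := by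
  have hr : 0 < ‖X‖ := by linarith
  have hr1 : 1 ≤ ‖X‖ := by linarith
  have hi0 : 0 ≤ ‖X‖⁻¹ := inv_nonneg.2 hr.le
  have hi1 : ‖X‖⁻¹ ≤ 1 := inv_le_one_of_one_le₀ hr1
  have hβ0 : 0 ≤ ‖X‖⁻¹ ^ 8 - ‖X‖⁻¹ ^ 14 := by
    have : ‖X‖⁻¹ ^ 14 ≤ ‖X‖⁻¹ ^ 8 := pow_le_pow_of_le_one hi0 hi1 (by norm_num)
    linarith
  have hβ1 : ‖X‖⁻¹ ^ 8 - ‖X‖⁻¹ ^ 14 ≤ ‖X‖⁻¹ ^ 8 := by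
    have : 0 ≤ ‖X‖⁻¹ ^ 14 := pow_nonneg hi0 _
    linarith
  have hinner : |⟪X, v⟫| ≤ ‖X‖ * ‖v‖ := abs_real_inner_le_norm _ _
  rw [abs_mul, abs_of_nonneg hβ0]
  calc (‖X‖⁻¹ ^ 8 - ‖X‖⁻¹ ^ 14) * |⟪X, v⟫| ≤ ‖X‖⁻¹ ^ 8 * (‖X‖ * ‖v‖) :=
        mul_le_mul hβ1 hinner (abs_nonneg _) (pow_nonneg hi0 _)
    _ = ‖X‖⁻¹ ^ 7 * ‖v‖ := by
        have h1 : ‖X‖⁻¹ ^ 8 * ‖X‖ = ‖X‖⁻¹ ^ 7 := by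
          rw [pow_succ, mul_assoc, inv_mul_cancel₀ hr.ne', mul_one]
        rw [← mul_assoc, h1]
    _ ≤ (6 : ℝ)⁻¹ ^ 7 * ‖v‖ := by
        refine mul_le_mul_of_nonneg_right ?_ (norm_nonneg _)
        exact pow_le_pow_left₀ hi0 ((inv_le_inv₀ hr (by norm_num)).2 hX) 7

/-- The decidable cell-box test `36·SC ≤ (fjQ c w bb).lo` puts label `bb` at distance `≥ 6` from the REFERENCE atom `X_bb(affShuf J c U)`, for every
`U` of the entry box. [formal bookkeeping: `six_le_norm_of_lo` at the reference shuffle, which lies in the cell box by §1] -/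
theorem six_le_norm_ref_of_lo {p : HTCert} {Q : Fin 3 → ℤ} {Gn : ℤ} {J : Fin 3 → Fin 3 × Fin 3 → ℤ} {c w : (Fin 3 × Fin 3) ⊕ Fin 3 → ℤ}
    (h : htCertSideA2QS p Q Gn J c w = true) (U : E3 →L[ℝ] E3)
    (hbox : ∀ ab : Fin 3 × Fin 3, |(U (EuclideanSpace.single ab.2 (1 : ℝ))) ab.1 - (c (Sum.inl ab) : ℝ) / SC| ≤ (w (Sum.inl ab) : ℝ) / SC)
    {bb : Fin 3 → ℤ} (h36 : 36 * (SC : ℤ) ≤ (fjQ c w bb).lo) : 6 ≤ ‖latPt U hexFrame bb + U (hcpShift + affShuf J c U)‖ :=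
  six_le_norm_of_lo U hbox (affShuf J c U) (affShuf_mem_box_of_certSide h U hbox) h36

/-! ## §4. ★ `hf₀` over an arbitrary label set, with the symmetric-difference correction -/

/-- ★ **`hf₀` OVER AN ARBITRARY LABEL FINSET `B'`** (e.g. the slab's own certainly-inside set of the exterior certificate): if every label of the
symmetric difference `B' △ htBU` passes the cell-box test `36·SC ≤ (fjQ c w bb).lo`, then
`|Σ_{bb ∈ B'} β ⟪X_bb(ξ₀), U(ξ − ξ₀)⟫| ≤ (p.Gs/SC + (#(B' \ B) + #(B \ B'))·6⁻⁷) · ‖U(ξ − ξ₀)‖`, `B = (htBU c w).toFinset`, `ξ₀ = affShuf J c U`.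
[folklore: `Σ_{B'} = Σ_{B} + Σ_{B' \ B} − Σ_{B \ B'}` (finset algebra), §2 for the first sum, §3 termwise for the two corrections] -/
theorem refForce_le_of_certSide_corr {p : HTCert} {Q : Fin 3 → ℤ} {Gn : ℤ} {J : Fin 3 → Fin 3 × Fin 3 → ℤ} {c w : (Fin 3 × Fin 3) ⊕ Fin 3 → ℤ}
    (h : htCertSideA2QS p Q Gn J c w = true) (U : E3 →L[ℝ] E3) (hU : ‖U - 1‖ ≤ 1 / 4)
    (hbox : ∀ ab : Fin 3 × Fin 3, |(U (EuclideanSpace.single ab.2 (1 : ℝ))) ab.1 - (c (Sum.inl ab) : ℝ) / SC| ≤ (w (Sum.inl ab) : ℝ) / SC)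
    (B' : Finset (Fin 3 → ℤ))
    (hcorr : ∀ bb ∈ (B' \ (htBU c w).toFinset) ∪ ((htBU c w).toFinset \ B'), 36 * (SC : ℤ) ≤ (fjQ c w bb).lo) (ξ : E3) :
    |∑ bb ∈ B', (‖latPt U hexFrame bb + U (hcpShift + affShuf J c U)‖⁻¹ ^ 8 - ‖latPt U hexFrame bb + U (hcpShift + affShuf J c U)‖⁻¹ ^ 14) *
        ⟪latPt U hexFrame bb + U (hcpShift + affShuf J c U), U (ξ - affShuf J c U)⟫| ≤
      ((p.Gs : ℝ) / SC + ((B' \ (htBU c w).toFinset).card + ((htBU c w).toFinset \ B').card) * (6 : ℝ)⁻¹ ^ 7) * ‖U (ξ - affShuf J c U)‖ := by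
  classical
  set ξ₀ : E3 := affShuf J c U with hξ₀
  set B : Finset (Fin 3 → ℤ) := (htBU c w).toFinset with hB
  set F : (Fin 3 → ℤ) → ℝ := fun bb => (‖latPt U hexFrame bb + U (hcpShift + ξ₀)‖⁻¹ ^ 8 - ‖latPt U hexFrame bb + U (hcpShift + ξ₀)‖⁻¹ ^ 14) *
      ⟪latPt U hexFrame bb + U (hcpShift + ξ₀), U (ξ - ξ₀)⟫ with hF
  -- finset algebra: Σ_{B'} + Σ_{B \ B'} = Σ_{B} + Σ_{B' \ B}
  have hsplit : ∑ bb ∈ B', F bb + ∑ bb ∈ B \ B', F bb = ∑ bb ∈ B, F bb + ∑ bb ∈ B' \ B, F bb := by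
    rw [← Finset.sum_union (Finset.disjoint_sdiff), ← Finset.sum_union (Finset.disjoint_sdiff), Finset.union_sdiff_self_eq_union,
      Finset.union_sdiff_self_eq_union, Finset.union_comm]
  have heq : ∑ bb ∈ B', F bb = ∑ bb ∈ B, F bb + ∑ bb ∈ B' \ B, F bb - ∑ bb ∈ B \ B', F bb := by linarith
  -- the main term
  have hmain : |∑ bb ∈ B, F bb| ≤ (p.Gs : ℝ) / SC * ‖U (ξ - ξ₀)‖ := refForce_htBU_le_of_certSide h U hU hbox ξ
  -- the two corrections, termwise
  have hterm : ∀ bb ∈ (B' \ B) ∪ (B \ B'), |F bb| ≤ (6 : ℝ)⁻¹ ^ 7 * ‖U (ξ - ξ₀)‖ := fun bb hbb =>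
    abs_forceTerm_le_of_six_le (six_le_norm_ref_of_lo h U hbox (hcorr bb hbb))
  have h1 : |∑ bb ∈ B' \ B, F bb| ≤ (B' \ B).card * ((6 : ℝ)⁻¹ ^ 7 * ‖U (ξ - ξ₀)‖) := by
    refine (Finset.abs_sum_le_sum_abs _ _).trans ?_
    have := Finset.sum_le_card_nsmul (B' \ B) (fun bb => |F bb|) ((6 : ℝ)⁻¹ ^ 7 * ‖U (ξ - ξ₀)‖)
      (fun bb hbb => hterm bb (Finset.mem_union_left _ hbb))
    simpa [nsmul_eq_mul] using this
  have h2 : |∑ bb ∈ B \ B', F bb| ≤ (B \ B').card * ((6 : ℝ)⁻¹ ^ 7 * ‖U (ξ - ξ₀)‖) := by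
    refine (Finset.abs_sum_le_sum_abs _ _).trans ?_
    have := Finset.sum_le_card_nsmul (B \ B') (fun bb => |F bb|) ((6 : ℝ)⁻¹ ^ 7 * ‖U (ξ - ξ₀)‖)
      (fun bb hbb => hterm bb (Finset.mem_union_right _ hbb))
    simpa [nsmul_eq_mul] using this
  rw [heq]
  calc |∑ bb ∈ B, F bb + ∑ bb ∈ B' \ B, F bb - ∑ bb ∈ B \ B', F bb|
      ≤ |∑ bb ∈ B, F bb| + |∑ bb ∈ B' \ B, F bb| + |∑ bb ∈ B \ B', F bb| := by
        have e1 := abs_sub (∑ bb ∈ B, F bb + ∑ bb ∈ B' \ B, F bb) (∑ bb ∈ B \ B', F bb)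
        have e2 := abs_add_le (∑ bb ∈ B, F bb) (∑ bb ∈ B' \ B, F bb)
        linarith
    _ ≤ (p.Gs : ℝ) / SC * ‖U (ξ - ξ₀)‖ + (B' \ B).card * ((6 : ℝ)⁻¹ ^ 7 * ‖U (ξ - ξ₀)‖) + (B \ B').card * ((6 : ℝ)⁻¹ ^ 7 * ‖U (ξ - ξ₀)‖) :=
        add_le_add (add_le_add hmain h1) h2
    _ = ((p.Gs : ℝ) / SC + ((B' \ B).card + (B \ B').card) * (6 : ℝ)⁻¹ ^ 7) * ‖U (ξ - ξ₀)‖ := by ring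

end Summit.AtomisticToContinuum.Crystallization.Theorems.FrustratedLawDichotomyStrainedPatchHomEntryLeafHT
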